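import Mathlib
import Summits.NavierStokesRegularity.NavierStokesRegularity.Theorems.WakeRatchetTailRatchetScalarFrontAction
import Summits.NavierStokesRegularity.NavierStokesRegularity.Theorems.WakeRatchetTailRatchetScalarFrontRetention
import Summits.NavierStokesRegularity.NavierStokesRegularity.Theorems.WakeRatchetTailRatchetScalarFrontFloor
import HarnessLib

/-!
# Scalar dyadic fronts (construction `DyadicScalarFronts`, stmt-NavierStokesRegularity-21808):
# the ACTION FLOOR `A·e^{A/Λ} ≥ F⋆` and the HOP WINDOW in terms of spread and action

Support file for the crux `WakeRatchet.TailRatchet` (stmt-21808; refuted BY NAME modulo the construction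
`WakeRatchetDyadicFront.DyadicScalarFronts`, p589335; MODEL lattice ODEs of Tao 2016 §1.2, §4 — nothing here
concerns the Navier–Stokes equations, and no item is closed).  Synthesis of this hand's a-priori package
(census memo `G2G3-APRIORI-21808-leafhand4-g6.md`):

* `action_floor` — every non-trivial profile of `DyadicScalarFronts` has action `A = ∫_{t<0} a` with
  `A·e^{A/Λ} ≥ F⋆ = 1/(Λ − Λ⁻¹)` (amplitude floor `sup|t|a ≥ F⋆` of `WakeRatchetScalarFrontFloor` against
  `|t|a ≤ A e^{A/Λ}` of `…ScalarFrontAction`); in particular `A ≥ min(Λ, F⋆/e)` (`action_floor_explicit`) — the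
  admissibility constant of the carried eternal solution cannot be small at fine scale ratio
  (`F⋆/e > 1/(14e·ε₀)` for `ε₀ ≤ 1`);
* `hop_window` — the hop ratio of every non-trivial profile lies in the window
  `1 + 1/((6Λ+2Λ⁻¹)(m_A + Λm_A² + m_A²/Λ)) ≤ s` and `s² ≤ Λ² − Λ(Λ−1)e^{−A/Λ}/4`, `m_A = A e^{A/Λ}`: both
  degenerate ends (`s → 1⁺`: no pulse; `s → Λ⁻`: perfect conveyor) are excluded by the spread and the action.

HONEST FRAMING: elementary consequences of this hand's helper files about a MODEL lattice ODE; existence of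
fronts is NOT proved; nothing about Navier–Stokes.
-/

noncomputable section

set_option linter.dupNamespace false

namespace Summit.NavierStokesRegularity.NavierStokesRegularity.Theorems

namespace WakeRatchetScalarFrontHopWindow

open Filter Topology Set MeasureTheory
open Literature.Analysis.FluidPDE Literature.Analysis.FluidPDE.TaoCascade
open WakeRatchetScalarFrontFloor WakeRatchetScalarFrontAction WakeRatchetScalarFrontRetention
open WakeRatchetScalarFrontPositive

variable {ε₀ s : ℝ} {a : ℝ → ℝ}

/-- **Action floor.**  Every non-trivial profile of `DyadicScalarFronts` has `1 ≤ (Λ − Λ⁻¹)·A·e^{A/Λ}`,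
`A = ∫_{t<0} a`. [cite: Tao2016AveragedNS, §1.2, §4 Lemma 4.1 (4.8); elementary] -/
theorem action_floor (hε : 0 < ε₀) (hs : 1 < s)
    (hode : ∀ t : ℝ, t < 0 → HasDerivAt a
      (bigLam ε₀ / s ^ 2 * a (t / s) ^ 2 - s / bigLam ε₀ * a t * a (s * t)) t)
    (hint : IntegrableOn a (Iio 0))
    (hbdd : ∃ t₀ : ℝ, t₀ < 0 ∧ ∃ P : ℝ, ∀ t : ℝ, t₀ ≤ t → t < 0 → |a t| ≤ P)
    (hne : ∃ t : ℝ, t < 0 ∧ a t ≠ 0) :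
    1 ≤ (bigLam ε₀ - (bigLam ε₀)⁻¹)
      * ((∫ v in Iio 0, a v) * Real.exp ((∫ v in Iio 0, a v) / bigLam ε₀)) :=
  scalarFront_one_le hε hs hode hint hbdd hne (typeI_of_action hε hs hode hint hbdd)

/-- **Explicit action floor**: `A ≥ min(Λ, F⋆/e)` with `F⋆ = 1/(Λ − Λ⁻¹)`.
[cite: Tao2016AveragedNS, §1.2, §4; elementary] -/
theorem action_floor_explicit (hε : 0 < ε₀) (hs : 1 < s)
    (hode : ∀ t : ℝ, t < 0 → HasDerivAt a
      (bigLam ε₀ / s ^ 2 * a (t / s) ^ 2 - s / bigLam ε₀ * a t * a (s * t)) t)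
    (hint : IntegrableOn a (Iio 0))
    (hbdd : ∃ t₀ : ℝ, t₀ < 0 ∧ ∃ P : ℝ, ∀ t : ℝ, t₀ ≤ t → t < 0 → |a t| ≤ P)
    (hne : ∃ t : ℝ, t < 0 ∧ a t ≠ 0) :
    min (bigLam ε₀) (1 / ((bigLam ε₀ - (bigLam ε₀)⁻¹) * Real.exp 1)) ≤ ∫ v in Iio 0, a v := by
  have hΛ : 0 < bigLam ε₀ := bigLam_pos (by linarith)
  have hΛ1 : 1 < bigLam ε₀ := by unfold bigLam; exact Real.one_lt_rpow (by linarith) (by norm_num)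
  have hc : 0 < bigLam ε₀ - (bigLam ε₀)⁻¹ := by
    have : (bigLam ε₀)⁻¹ < 1 := inv_lt_one_of_one_lt₀ hΛ1; linarith
  set A : ℝ := ∫ v in Iio 0, a v with hA
  have h := action_floor hε hs hode hint hbdd hne
  by_cases hAΛ : bigLam ε₀ ≤ A
  · exact (min_le_left _ _).trans hAΛ
  · push Not at hAΛ
    -- `A < Λ`: then `e^{A/Λ} ≤ e`, so `1 ≤ c A e`
    have hexp : Real.exp (A / bigLam ε₀) ≤ Real.exp 1 := by
      apply Real.exp_le_exp.2
      rw [div_le_one hΛ]; exact hAΛ.le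
    have hA0 : 0 ≤ A := by
      have hnn := nonneg_of_front hε hs hode hint hbdd
      exact setIntegral_nonneg measurableSet_Iio fun u hu => hnn u hu
    have h1 : 1 ≤ (bigLam ε₀ - (bigLam ε₀)⁻¹) * (A * Real.exp 1) := by
      calc (1:ℝ) ≤ (bigLam ε₀ - (bigLam ε₀)⁻¹) * (A * Real.exp (A / bigLam ε₀)) := h
        _ ≤ (bigLam ε₀ - (bigLam ε₀)⁻¹) * (A * Real.exp 1) :=
            mul_le_mul_of_nonneg_left (mul_le_mul_of_nonneg_left hexp hA0) hc.le
    refine (min_le_right _ _).trans ?_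
    rw [div_le_iff₀ (mul_pos hc (Real.exp_pos 1))]
    linarith

/-- **The hop window.**  For every non-trivial profile of `DyadicScalarFronts`, with `A = ∫_{t<0} a` and
`m_A = A·e^{A/Λ}`:  `1 + 1/((6Λ + 2Λ⁻¹)(m_A + Λm_A² + m_A²/Λ)) ≤ s` and `s² ≤ Λ² − Λ(Λ−1)e^{−A/Λ}/4`.
[cite: Tao2016AveragedNS, §1.2, §4 (4.1); elementary] -/
theorem hop_window (hε : 0 < ε₀) (hs : 1 < s)
    (hode : ∀ t : ℝ, t < 0 → HasDerivAt a
      (bigLam ε₀ / s ^ 2 * a (t / s) ^ 2 - s / bigLam ε₀ * a t * a (s * t)) t)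
    (hint : IntegrableOn a (Iio 0))
    (hbdd : ∃ t₀ : ℝ, t₀ < 0 ∧ ∃ P : ℝ, ∀ t : ℝ, t₀ ≤ t → t < 0 → |a t| ≤ P)
    (hne : ∃ t : ℝ, t < 0 ∧ a t ≠ 0) :
    1 + 1 / ((6 * bigLam ε₀ + 2 / bigLam ε₀) *
        (((∫ v in Iio 0, a v) * Real.exp ((∫ v in Iio 0, a v) / bigLam ε₀))
          + bigLam ε₀ * ((∫ v in Iio 0, a v) * Real.exp ((∫ v in Iio 0, a v) / bigLam ε₀)) ^ 2
          + ((∫ v in Iio 0, a v) * Real.exp ((∫ v in Iio 0, a v) / bigLam ε₀)) ^ 2 / bigLam ε₀)) ≤ s ∧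
      s ^ 2 ≤ bigLam ε₀ ^ 2
        - bigLam ε₀ * (bigLam ε₀ - 1) * Real.exp (-((∫ v in Iio 0, a v) / bigLam ε₀)) / 4 := by
  have hΛ : 0 < bigLam ε₀ := bigLam_pos (by linarith)
  have hΛ1 : 1 < bigLam ε₀ := by unfold bigLam; exact Real.one_lt_rpow (by linarith) (by norm_num)
  have hc : 0 < bigLam ε₀ - (bigLam ε₀)⁻¹ := by
    have : (bigLam ε₀)⁻¹ < 1 := inv_lt_one_of_one_lt₀ hΛ1; linarith
  set mA : ℝ := (∫ v in Iio 0, a v) * Real.exp ((∫ v in Iio 0, a v) / bigLam ε₀) with hmA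
  have h1 := no_slow_front_action hε hs hode hint hbdd hne
  have h2 := (one_sub_dssMu_ge hε hs hode hint hbdd hne).1
  -- `mA > 0` from the action floor
  have hfl := action_floor hε hs hode hint hbdd hne
  have hmA0 : 0 < mA := by
    by_contra h
    push Not at h
    have : (bigLam ε₀ - (bigLam ε₀)⁻¹) * mA ≤ 0 := mul_nonpos_of_nonneg_of_nonpos hc.le h
    linarith
  have hK : 0 < mA + bigLam ε₀ * mA ^ 2 + mA ^ 2 / bigLam ε₀ := by positivity
  have hden : 0 < 6 * bigLam ε₀ + 2 / bigLam ε₀ := by positivity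
  refine ⟨?_, by linarith [h2]⟩
  have h3 : 1 / ((6 * bigLam ε₀ + 2 / bigLam ε₀) * (mA + bigLam ε₀ * mA ^ 2 + mA ^ 2 / bigLam ε₀)) ≤ s - 1 := by
    rw [div_le_iff₀ (mul_pos hden hK)]
    rw [div_le_iff₀ hden] at h1
    linarith [h1]
  linarith

end WakeRatchetScalarFrontHopWindow

end Summit.NavierStokesRegularity.NavierStokesRegularity.Theorems

end
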